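/-
Copyright (c) 2026. All rights reserved.
Released under Apache 2.0 license as described in the file LICENSE.
Authors: abc-iut cell, seat abc-iut-L4-t9 (gen 5; [AbsTopIII] Prop 3.2 (v), reading of the categories).
-/
import Literature.AnabelianGeometry.AbsoluteAnabelian.MLFGaloisLogFrobeniusFactorization
import Literature.AnabelianGeometry.AbsoluteAnabelian.MLFGaloisNaturalFunctorsWitness
import Mathlib.CategoryTheory.Core

/-!
# [AbsTopIII] Prop 3.2 (v): the power endomorphisms `(𝟙_Π, x ↦ xⁿ)` obstruct the 1-factorization on the
# plain categories `𝒞^MLF_T`; the factorization on the isomorphism subcategories (as Cor 3.6/3.7 use it)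

S. Mochizuki, *Topics in absolute anabelian geometry III* [MochizukiAbsTopIII2015] (kurims manuscript
`paper:url-5493eb38cbb7`, read on the page).  Def 3.1 (i) p. 66: "`TM`: torsion-cyclotomic
ind-topological abelian monoids and homomorphisms of ind-topological monoids"; Def 3.1 (ii) p. 67: "A
morphism of MLF-Galois `T`-pairs `φ : (Π₁ ↷ M₁) → (Π₂ ↷ M₂)` consists of a morphism of objects
`φ_M : M₁ → M₂` of `T`, together with a compatible [...] continuous homomorphism of topological groups
`φ_Π : Π₁ → Π₂` that induces an open injective homomorphism between the respective arithmetic Galois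
groups"; Prop 3.2 (v) p. 72 l. 29–42: "The algorithm of (iii) yields a natural [1-]factorization
`𝒞^{MLF-sB}_TF ⟶ 𝒞^{MLF-sB}_T ⟶^{𝔩𝔬𝔤_{T,T′}} 𝒞^{MLF-sB}_{T′}` [...] Moreover, the functor `𝔩𝔬𝔤_{T,T}` is
isomorphic to the identity functor [hence, in particular, is an equivalence of categories]."; Def 3.1
(iii) p. 67: "we shall use the same notation, except with `𝒞` replaced by [underlined `𝒞`'s] to denote
the various subcategories determined by the `T`-isomorphisms (respectively, Galois-isomorphisms;
isomorphisms)"; Cor 3.6 p. 79 / Cor 3.7 p. 86 apply `𝔩𝔬𝔤` through "the evident restrictions" to these.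

Sequel to `MLFGaloisLogFrobeniusFactorization.lean` (this seat), which typed print's (v) on the PLAIN
categories `𝒞^{MLF-S}_T` (all Def 3.1 (ii) morphisms) over the parameter `Prop32iiiAlgorithm S` and
proved `Nonempty (Prop32iiiAlgorithm S) ↔ (tfToTMOn S).Full`.  This file settles that parameter:

* (A) OBSTRUCTION ON THE PLAIN CATEGORIES (our kernel theorem, unconditional).  For every pair
  `(Π ↷ M)` and `n : ℕ`, `(𝟙_Π, x ↦ xⁿ)` is an endomorphism of the pair (`GaloisMonoidPair.powEnd`: a
  homomorphism of monoids, equivariant, inducing the identity on arithmetic Galois groups — a morphism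
  of MLF-Galois `TM`-pairs in the sense of Def 3.1 (ii) as printed).  For the integers `(Π ↷ 𝒪^⊳)` of an
  MLF-Galois `TF`-pair and `n = 2` it is NOT the restriction of any field homomorphism (`-1 ↦ 1`, but
  `char M = 0`): `tfToTMCompact_map_ne_powEnd_two`.  Hence `𝒞^{S}_TF → 𝒞^{S}_TM` is full for NO
  non-empty `S` (`not_full_tfToTMOn`), `tfToTMCompact` is not full (`tfToTMCompact_not_full`), and
  **`Prop32iiiAlgorithm S` is inhabited iff `S` is EMPTY** (`nonempty_prop32iiiAlgorithm_iff_isEmpty`): read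
  on the plain categories with all Def 3.1 (ii) morphisms, the two printed sentences of (v) for `T = TM`
  ("1-factorization" for `T′ = TF` + "`𝔩𝔬𝔤_{TM,TM}` is isomorphic to the identity functor") would make
  `𝒞^{MLF-sB}_TF → 𝒞^{MLF-sB}_TM` an equivalence, which the power endomorphisms forbid.  READING
  CONSEQUENCE (ours, recorded for the referees — not a claim that the printed mathematics fails): (v) is to
  be read on the ISOMORPHISM subcategories of Def 3.1 (iii) (double-underlined / Galois-isomorphisms),
  where the power maps (`n ≥ 2`: not injective on roots of unity) are not morphisms, consistently with
  Prop 3.2 (iv) (`Isom_{𝒞_TM} ≅ Isom_{𝒯𝒢} ≅ Isom_{𝒞_TF}` for strictly Belyi type) and with Cor 3.6/3.7.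
* (B) THE FACTORIZATION ON THE ISOMORPHISM SUBCATEGORIES (Mathlib `Core`): `tfToTMOnCore S` (faithful,
  essentially surjective — unconditional), `Prop32iiiAlgorithmIso S` (the algorithm of (iii) as a functor
  on isomorphisms with unit/counit), the printed sentences over it (`equivalence`, `factorTF`, `factorTM`,
  `mlfLogFrobeniusTMToTMIsoId`, `isEquivalence_mlfLogFrobeniusTMToTM`), and the residual
  `nonempty_prop32iiiAlgorithmIso_iff_full : Nonempty (Prop32iiiAlgorithmIso S) ↔ (tfToTMOnCore S).Full` —
  "every ISOMORPHISM `(Π ↷ 𝒪^⊳) ⥲ (Π′ ↷ 𝒪′^⊳)` between `S`-pairs lifts to an isomorphism of the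
  fields" = the surjectivity clause of Prop 3.2 (iv) for `T = TM` (strictly Belyi type: print, via Cor 1.10;
  campaign-L; NOT asserted; for mono-analytic pairs it fails by non-geometric automorphisms of `G_k`).

HONEST FRAMING: refereed pre-IUT material; (A) is a kernel theorem about OUR typing of Def 3.1 (ii),
which transcribes print's "morphism of objects of `T`" literally; (B) is formal over an explicit parameter.
No instance, no notation.  Nothing here bears on [IUTchIII] Cor 3.12 or takes a side; typed ≠ proved.
-/

noncomputable section

universe u

namespace Literature.AnabelianGeometry.AbsoluteAnabelian

open _root_.CategoryTheory

/-! ## (A) The power endomorphisms and the failure of fullness on the plain categories -/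

namespace GaloisMonoidPair

/-- **The `n`-th power endomorphism `(𝟙_Π, x ↦ xⁿ)` of a pair `(Π ↷ M)`** (`T ∈ {TCG, TLG, TM}`): a
homomorphism of (abelian) monoids, `Π`-equivariant (`(g • x)ⁿ = g • xⁿ`), inducing the identity — an open
injective homomorphism — on arithmetic Galois groups; i.e. a morphism of pairs in the sense of Def 3.1 (ii).
[cite: MochizukiAbsTopIII2015, Definition 3.1 (ii) p.67] -/
def powEnd (P : GaloisMonoidPair.{u}) (n : ℕ) : P ⟶ P where
  homPi := MonoidHom.id _
  continuous_homPi := continuous_id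
  homM := powMonoidHom n
  smul_comm g x := by
    change (g • x) ^ n = g • x ^ n
    rw [smul_pow']
  comap_ker := Subgroup.comap_id _
  isOpen_image U hU := by
    have : U.map (MonoidHom.id P.Pi) ⊔ P.actionKer = U ⊔ P.actionKer := by rw [Subgroup.map_id]
    rw [this]
    exact Subgroup.isOpen_mono le_sup_left hU

/-- `powEnd` is the identity on `Π`. [cite: MochizukiAbsTopIII2015, Definition 3.1 (ii) p.67] -/
@[simp] theorem powEnd_homPi_apply (P : GaloisMonoidPair.{u}) (n : ℕ) (g : P.Pi) :
    GaloisMonoidPair.Hom.homPi (P.powEnd n) g = g := rfl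

/-- `powEnd` is `x ↦ xⁿ` on `M`. [cite: MochizukiAbsTopIII2015, Definition 3.1 (ii) p.67] -/
@[simp] theorem powEnd_homM_apply (P : GaloisMonoidPair.{u}) (n : ℕ) (x : P.M) :
    GaloisMonoidPair.Hom.homM (P.powEnd n) x = x ^ n := rfl

end GaloisMonoidPair

namespace GaloisFieldPair

variable {P : GaloisFieldPair.{u}}

/-- The field of an MLF-Galois `TF`-pair has characteristic `0` (`M ≅ k̄ ⊇ k ⊇ ℚ`).
[cite: MochizukiAbsTopIII2015, Definition 3.1 (ii) p.67] -/
theorem charZero_of_isMLFGaloisFieldPair (hP : IsMLFGaloisFieldPair P) : CharZero P.M := by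
  obtain ⟨C, D, ⟨e⟩⟩ := hP.exists_model
  haveI : CharZero C.K := charZero_of_injective_algebraMap (algebraMap C.k C.K).injective
  let f : P.M →+* C.K := e.isoM.symm.toRingHom
  exact f.charZero

/-- `-1` is an intrinsic non-zero integer of an MLF-Galois `TF`-pair (`-1 ∈ 𝒪_k̄^⊳`, transported).
[cite: MochizukiAbsTopIII2015, Definition 3.1 (iii) p.68] -/
theorem neg_one_mem_intrinsicNonzeroIntegers (hP : IsMLFGaloisFieldPair P) :
    (-1 : P.M) ∈ P.intrinsicNonzeroIntegers hP := by
  obtain ⟨C, D, ⟨e⟩⟩ := hP.exists_model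
  rw [← map_nonzeroIntegers_eq_intrinsicNonzeroIntegers C D hP e, Submonoid.mem_map]
  refine ⟨-1, ⟨Subalgebra.neg_mem _ (Subalgebra.one_mem _), neg_ne_zero.mpr one_ne_zero⟩, ?_⟩
  change e.isoM (-1) = -1
  rw [map_neg, map_one]

end GaloisFieldPair

/-- **The squaring endomorphism of `(Π ↷ 𝒪^⊳)` is not the restriction of any morphism of `TF`-pairs**
(a field homomorphism sends `-1 ↦ -1`, squaring sends `-1 ↦ 1`, and `-1 ≠ 1` in characteristic `0`).
[cite: MochizukiAbsTopIII2015, Proposition 3.2 (v) p.72] -/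
theorem tfToTMCompact_map_ne_powEnd_two (P : MLFGaloisFieldPairCompactCat.{u}) (ψ : P ⟶ P) :
    tfToTMCompact.map ψ ≠ InducedCategory.homMk ((tfToTMCompact.obj P).obj.powEnd 2) := by
  intro h
  haveI := GaloisFieldPair.charZero_of_isMLFGaloisFieldPair (P := P.obj) P.property.1
  haveI := P.property.2
  have hP := P.property.1
  have hm := GaloisFieldPair.neg_one_mem_intrinsicNonzeroIntegers (P := P.obj) hP
  -- the underlying equation of morphisms of pairs `(ψ_Π, ψ_M|_{𝒪^⊳}) = (𝟙, x ↦ x²)`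
  have h' : GaloisFieldPair.Hom.integers (P := P.obj) (Q := P.obj) ψ.hom hP hP
      (fun U hU => GaloisFieldPair.Hom.finiteIndex_sat_of_compactSpace (P := P.obj) (Q := P.obj) ψ.hom U hU) =
      (P.obj.integersPair hP).powEnd 2 :=
    congrArg InducedCategory.Hom.hom h
  -- evaluate at `-1 ∈ 𝒪^⊳`
  have h1 := congrArg
    (fun χ : (P.obj.integersPair hP).Hom (P.obj.integersPair hP) => ((χ.homM ⟨-1, hm⟩ : (P.obj.integersPair hP).M) : P.obj.M)) h'
  change GaloisFieldPair.Hom.homM (P := P.obj) (Q := P.obj) ψ.hom (-1) = (-1 : P.obj.M) ^ 2 at h1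
  rw [map_neg, map_one, neg_one_sq] at h1
  exact (neg_ne_self.mpr (one_ne_zero : (1 : P.obj.M) ≠ 0)) h1

/-- **`𝒞^c_TF → 𝒞^c_TM` is NOT full** (at the genuine `ℚ₂` object of abc-iut-L4-t2's witness file).
[cite: MochizukiAbsTopIII2015, Proposition 3.2 (v) p.72] -/
theorem tfToTMCompact_not_full : ¬ tfToTMCompact.{0}.Full := by
  intro hfull
  obtain ⟨P⟩ := nonempty_mlfGaloisFieldPairCompactCat
  obtain ⟨ψ, hψ⟩ := hfull.map_surjective (InducedCategory.homMk ((tfToTMCompact.obj P).obj.powEnd 2))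
  exact tfToTMCompact_map_ne_powEnd_two P ψ hψ

variable (S : ObjectProperty MLFGaloisFieldPairCompactCat.{u})

/-- **`𝒞^{S}_TF → 𝒞^{S}_TM` is full for NO non-empty `S`.** [cite: MochizukiAbsTopIII2015, Proposition 3.2 (v) p.72] -/
theorem not_full_tfToTMOn (h : ∃ P, S P) : ¬ (tfToTMOn S).Full := by
  intro hfull
  obtain ⟨P, hP⟩ := h
  let X : S.FullSubcategory := ⟨P, hP⟩
  obtain ⟨ψ, hψ⟩ := hfull.map_surjective (X := X) (Y := X)
    (InducedCategory.homMk (InducedCategory.homMk ((tfToTMCompact.obj P).obj.powEnd 2)))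
  have h' := congrArg InducedCategory.Hom.hom hψ
  exact tfToTMCompact_map_ne_powEnd_two P ψ.hom h'

/-- For EMPTY `S` the functor is (vacuously) full. [cite: MochizukiAbsTopIII2015, Proposition 3.2 (v) p.72] -/
theorem full_tfToTMOn_of_isEmpty (h : ∀ P, ¬ S P) : (tfToTMOn S).Full :=
  ⟨fun {X} _ => (h X.obj X.property).elim⟩

/-- **The parameter `Prop32iiiAlgorithm S` of `MLFGaloisLogFrobeniusFactorization` — print's (v) on the PLAIN
categories — is inhabited IFF `S` is empty**: the algorithm of (iii) cannot be a quasi-inverse of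
`𝒞_TF → 𝒞_TM` on any class of pairs as long as the power maps are morphisms of `TM`-pairs; (v) must be
read on the isomorphism subcategories, part (B). [cite: MochizukiAbsTopIII2015, Proposition 3.2 (v) p.72] -/
theorem nonempty_prop32iiiAlgorithm_iff_isEmpty : Nonempty (Prop32iiiAlgorithm.{u} S) ↔ ∀ P, ¬ S P := by
  rw [nonempty_prop32iiiAlgorithm_iff_full]
  refine ⟨fun hfull P hP => not_full_tfToTMOn S ⟨P, hP⟩ hfull, full_tfToTMOn_of_isEmpty S⟩

/-- In particular for `S = ⊤` (all MLF-Galois `TF`-pairs with compact `Π`, universe `0`, where the genuine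
`ℚ₂` model lives) there is NO such datum. [cite: MochizukiAbsTopIII2015, Proposition 3.2 (v) p.72] -/
theorem isEmpty_prop32iiiAlgorithm_top : IsEmpty (Prop32iiiAlgorithm.{0} ⊤) := by
  rw [← not_nonempty_iff, nonempty_prop32iiiAlgorithm_iff_isEmpty]
  intro h
  obtain ⟨P⟩ := nonempty_mlfGaloisFieldPairCompactCat
  exact h P trivial

/-! ## (B) The 1-factorization of Prop 3.2 (v) on the isomorphism subcategories -/

/-- **`𝒞^{S}_TF → 𝒞^{S}_TM` on the isomorphism subcategories** (double-underlined `𝒞` of Def 3.1 (iii);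
Mathlib `Core`). [cite: MochizukiAbsTopIII2015, Definition 3.1 (iii) p.67] -/
def tfToTMOnCore : Core S.FullSubcategory ⥤ Core (tmPairsOf S).FullSubcategory := (tfToTMOn S).core

/-- It is faithful (unconditional). [cite: MochizukiAbsTopIII2015, Proposition 3.2 (v) p.72] -/
theorem tfToTMOnCore_faithful : (tfToTMOnCore S).Faithful := by
  haveI := tfToTMOn_faithful.{u} S
  refine ⟨fun {X Y} f g h => Core.hom_ext ((tfToTMOn S).map_injective ?_)⟩
  exact congrArg (fun φ : (tfToTMOnCore S).obj X ⟶ (tfToTMOnCore S).obj Y => φ.iso.hom) h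

/-- It is essentially surjective (unconditional). [cite: MochizukiAbsTopIII2015, Proposition 3.2 (v) p.72] -/
theorem tfToTMOnCore_essSurj : (tfToTMOnCore S).EssSurj := by
  haveI := tfToTMOn_essSurj.{u} S
  refine ⟨fun Q => ?_⟩
  obtain ⟨P, ⟨i⟩⟩ := Functor.EssSurj.mem_essImage (F := tfToTMOn S) Q.of
  exact ⟨⟨P⟩, ⟨Core.isoMk i⟩⟩

/-- **"The algorithm of (iii)" on ISOMORPHISMS of `S`-pairs, as DATA** — the parameter of part (B); NOT
constructed, NOT asserted (for `S` = strictly Belyi type it is the surjectivity clause of Prop 3.2 (iv) for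
`T = TM`, via Cor 1.10: campaign-L). [cite: MochizukiAbsTopIII2015, Proposition 3.2 (iii) p.72] -/
structure Prop32iiiAlgorithmIso : Type (u + 1) where
  /-- the algorithm of (iii) on isomorphisms: `(Π ↷ 𝒪^⊳) ↦ (Π ↷ k̄_reconstructed)`. -/
  R : Core (tmPairsOf S).FullSubcategory ⥤ Core S.FullSubcategory
  /-- (iii) recovers `k̄`, naturally in isomorphisms. -/
  unitIso : tfToTMOnCore S ⋙ R ≅ 𝟭 _
  /-- the integers of the reconstructed field are the given monoid, naturally in isomorphisms. -/
  counitIso : R ⋙ tfToTMOnCore S ≅ 𝟭 _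

namespace Prop32iiiAlgorithmIso

variable {S}

/-- **Prop 3.2 (v) on isomorphisms: `𝒞̳^{S}_TF ≌ 𝒞̳^{S}_TM`.** [cite: MochizukiAbsTopIII2015, Proposition 3.2 (v) p.72] -/
def equivalence (A : Prop32iiiAlgorithmIso.{u} S) :
    Core S.FullSubcategory ≌ Core (tmPairsOf S).FullSubcategory :=
  CategoryTheory.Equivalence.mk (tfToTMOnCore S) A.R A.unitIso.symm A.counitIso

/-- Given the datum, `𝒞̳^{S}_TF → 𝒞̳^{S}_TM` is full: every isomorphism of the integer pairs lifts to the
fields. [cite: MochizukiAbsTopIII2015, Proposition 3.2 (iv) p.72] -/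
theorem full (A : Prop32iiiAlgorithmIso.{u} S) : (tfToTMOnCore S).Full :=
  haveI := Functor.IsEquivalence.mk' A.R A.unitIso.symm A.counitIso
  inferInstance

/-- **`𝔩𝔬𝔤_{TM,TM}` on isomorphisms** := (algorithm of (iii)) ⋙ `𝔩𝔬𝔤_{TF,TM}` (log-coordinates).
[cite: MochizukiAbsTopIII2015, Proposition 3.2 (v) p.72] -/
def mlfLogFrobeniusTMToTM (A : Prop32iiiAlgorithmIso.{u} S) :
    Core (tmPairsOf S).FullSubcategory ⥤ Core (tmPairsOf S).FullSubcategory :=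
  A.R ⋙ tfToTMOnCore S

/-- **`𝔩𝔬𝔤_{TM,TF}` on isomorphisms** := (algorithm of (iii)) ⋙ `𝔩𝔬𝔤_{TF,TF}`.
[cite: MochizukiAbsTopIII2015, Proposition 3.2 (v) p.72] -/
def mlfLogFrobeniusTMToTF (A : Prop32iiiAlgorithmIso.{u} S) :
    Core (tmPairsOf S).FullSubcategory ⥤ Core MLFGaloisFieldPairCompactCat.{u} :=
  A.R ⋙ (S.ι ⋙ mlfLogFrobeniusTF).core

/-- **Prop 3.2 (v) on isomorphisms, `T′ = TF`: `𝔩𝔬𝔤_{TF,TF}|_S ≅ (𝒞_TF → 𝒞_TM) ⋙ 𝔩𝔬𝔤_{TM,TF}`.**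
[cite: MochizukiAbsTopIII2015, Proposition 3.2 (v) p.72] -/
def factorTF (A : Prop32iiiAlgorithmIso.{u} S) :
    (S.ι ⋙ mlfLogFrobeniusTF.{u}).core ≅ tfToTMOnCore S ⋙ A.mlfLogFrobeniusTMToTF :=
  (Functor.leftUnitor _).symm ≪≫ Functor.isoWhiskerRight A.unitIso.symm _ ≪≫ Functor.associator _ _ _

/-- **Prop 3.2 (v) on isomorphisms, `T′ = TM`: `𝔩𝔬𝔤_{TF,TM}|_S ≅ (𝒞_TF → 𝒞_TM) ⋙ 𝔩𝔬𝔤_{TM,TM}`.**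
[cite: MochizukiAbsTopIII2015, Proposition 3.2 (v) p.72] -/
def factorTM (A : Prop32iiiAlgorithmIso.{u} S) : tfToTMOnCore S ≅ tfToTMOnCore S ⋙ A.mlfLogFrobeniusTMToTM :=
  (Functor.leftUnitor _).symm ≪≫ Functor.isoWhiskerRight A.unitIso.symm _ ≪≫ Functor.associator _ _ _

/-- **Prop 3.2 (v): "`𝔩𝔬𝔤_{TM,TM}` is isomorphic to the identity functor"** (on isomorphisms).
[cite: MochizukiAbsTopIII2015, Proposition 3.2 (v) p.72] -/
def mlfLogFrobeniusTMToTMIsoId (A : Prop32iiiAlgorithmIso.{u} S) : A.mlfLogFrobeniusTMToTM ≅ 𝟭 _ :=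
  A.counitIso

/-- **Prop 3.2 (v): "hence, in particular, is an equivalence of categories"** (on isomorphisms).
[cite: MochizukiAbsTopIII2015, Proposition 3.2 (v) p.72] -/
theorem isEquivalence_mlfLogFrobeniusTMToTM (A : Prop32iiiAlgorithmIso.{u} S) :
    A.mlfLogFrobeniusTMToTM.IsEquivalence :=
  Functor.isEquivalence_of_iso A.mlfLogFrobeniusTMToTMIsoId.symm

end Prop32iiiAlgorithmIso

variable {S} in
/-- From fullness on isomorphisms to the datum (Mathlib's `Functor.asEquivalence`).
[cite: MochizukiAbsTopIII2015, Proposition 3.2 (v) p.72] -/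
def Prop32iiiAlgorithmIso.ofFull (h : (tfToTMOnCore S).Full) : Prop32iiiAlgorithmIso.{u} S :=
  haveI := h
  haveI := tfToTMOnCore_faithful.{u} S
  haveI := tfToTMOnCore_essSurj.{u} S
  haveI : (tfToTMOnCore S).IsEquivalence := {}
  { R := (tfToTMOnCore S).asEquivalence.inverse
    unitIso := (tfToTMOnCore S).asEquivalence.unitIso.symm
    counitIso := (tfToTMOnCore S).asEquivalence.counitIso }

/-- **THE RESIDUAL OF Prop 3.2 (v) ON THE ISOMORPHISM SUBCATEGORIES, kernel-pinned**: the algorithm of (iii)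
exists as a functorial datum on isomorphisms of `S`-pairs IFF every isomorphism `(Π ↷ 𝒪^⊳) ⥲ (Π′ ↷ 𝒪′^⊳)`
between `S`-pairs lifts to an isomorphism of the fields — the surjectivity of
`Isom_{𝒞_TF} → Isom_{𝒞_TM}`, cf. Prop 3.2 (iv) (both `≅ Isom_{𝒯𝒢}` for strictly Belyi type: Cor 1.10,
campaign-L; false for mono-analytic pairs). [cite: MochizukiAbsTopIII2015, Proposition 3.2 (iv) p.72] -/
theorem nonempty_prop32iiiAlgorithmIso_iff_full :
    Nonempty (Prop32iiiAlgorithmIso.{u} S) ↔ (tfToTMOnCore S).Full :=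
  ⟨fun ⟨A⟩ => A.full, fun h => ⟨Prop32iiiAlgorithmIso.ofFull h⟩⟩

end Literature.AnabelianGeometry.AbsoluteAnabelian

end
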